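import Literature.NumberTheory.EllipticCurves.SingularModuliClassGroupActionOrder
import Literature.NumberTheory.EllipticCurves.HeegnerPointsHeckeOrbitOrders
import Literature.NumberTheory.EllipticCurves.HeegnerPointsLevelTransportOrders
import Literature.NumberTheory.EllipticCurves.RingClassFieldClassNumber
import Literature.NumberTheory.ComplexMultiplication.CMLatticeOrderOfDiscriminant
import Summits.BirchSwinnertonDyer.BirchSwinnertonDyer.Theorems.SylvesterTwoHeegnerIndexLevelFixingTransportToFix
import HarnessLib

/-!
# Hasse's `η` for an ORDER: the `K`-automorphisms of `K[c] ⊂ ℂ` act on the singular moduli of discriminant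
# `c² d_K` through a group ISOMORPHISM `Gal(K[c]/K) ≃* Cl(𝒪_{c² d_K})` (translation law), class-field-theory-free
# (crux `UpperOffV0HSYPlus`, stmt-BirchSwinnertonDyer-19804; route `SylvesterTwoHeegnerIndex`, rung K7t; (W2-b) route (4.2))

Cell `bsd-cm`, seat `bsd-cm-k7t-c2` g33 ((W2-b) seat of record, planner D826 (3): «(4.2) = the level-`n` reduction of
`stub_levelFixingSeven`»).  Helper toward `stmt-BirchSwinnertonDyer-19804` (`--supports … --as helper`).  THEOREMS ONLY
(no definition, no named fact, no instance, no `sorry`).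

WHAT.  Let `K` be imaginary quadratic, `ι : K → ℂ`, `c ≥ 1`, `K[c] = ringClassField K ι c ⊂ ℂ` the tree's concrete ring class
field, and `Δ` the negative discriminant `c² d_K`.  The tree's `SingularModuliClassGroupAction.lean` (cell `bsd-goldfeld`)
builds, for the MAXIMAL order, Hasse's isomorphism `galClassEquiv : Gal(H_K/K) ≃* Cl(𝒪_{d_K})` with `s(j(κ)) = j(η(s)·κ)`,
without class field theory; k-ty1 g16's `SingularModuliClassGroupActionOrder.lean` proved the translation law
`σ(j(κ)) = j(η·κ)` for every `σ ∈ Aut(ℂ)` fixing `√D` and EVERY quadratic order (`exists_translation_classJ`,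
`apply_classJ_eq_classJ_mul_of_negDiscr`).  This file reruns the `galClassEquiv` construction for the order of conductor
`c`, i.e. for `K[c]` in place of `H_K`:

* `classJ_mem_ringClassField` — `j(κ) ∈ K[c]` for every `κ ∈ Cl(𝒪_{c² d_K})`;
* `exists_ringEquiv_extends` — every `s ∈ Gal(K[c]/K)` is the restriction of some `σ ∈ Aut(ℂ)`, which fixes `ι(K)`
  and `√(c² d_K)`;
* `existsUnique_gal_apply_classJ_one_eq`, `gal_apply_classJ_eq_classJ_mul` — `s(j(1)) = j(η)` for a unique `η`, and then
  `s(j(κ)) = j(η·κ)` for all `κ`;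
* ★ `exists_galClassEquiv_ringClassField` — **there is a group isomorphism `Φ : Gal(K[c]/K) ≃* Cl(𝒪_{c² d_K})` with
  `s(j(κ)) = j(Φ(s)·κ)` for all `s, κ`** (a hom by the translation law and `classJ_injective`; injective because an
  automorphism fixing `ι(K)` and one `j(τ_Q)` fixes `K[c]`, `eqOn_ringClassField_of_apply_formJ_eq`; bijective because
  `#Gal(K[c]/K) = h(c² d_K) = #Cl` — `card_algEquiv_ringClassField_eq_classNumber`, `natCard_classGroup_QO_of_emod_four`);
* `ringEquiv_apply_classJ_of_extends` / `eq_galClass_of_extends` — for `σ ∈ Aut(ℂ)` extending `s`: `σ(j(κ)) = j(Φ(s)·κ)`,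
  and any `η` with `σ(j(1)) = j(η)` IS `Φ(s)`.

USE (memo `W2B-RECIPROCITY-k7t-c2-g32.md` v2 §4.2, re-planned by g33 as PLAN Ω′, STATUS 2026-08-29T23:36Z): with `Φ` one can
NAME the element `ψ := Φ⁻¹(η*)` of `Gal(K[9pn]/K)` attached to the ambiguous class `η*` above `3`, and compare it with the
decomposition involution at `w ∣ 3` through ONE Chebotarev prime and ONE Kronecker congruence (sequel files).

HONEST LABEL: generic CM bookkeeping (Cox §11 / Darmon Thm. 3.3–3.7 for orders, the translation structure only — the
identification of `Φ` with the Artin map is NOT claimed); no stub closed; nothing asserted on 19804; X12.CMAtTwo NOT proved;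
BSD is proved for no curve.

## References
* D. A. Cox, *Primes of the form x² + ny²*, 2nd ed. (2013), §7.B Thm. 7.7, §7.D Thm. 7.24, §11.A Thm. 11.1, §11.D Cor. 11.37. [Cox2013]
* H. Darmon, *Rational points on modular elliptic curves*, CBMS 101 (2004), Thm. 3.3, Thm. 3.6–3.7. [Darmon2004]
* B. H. Gross, *Heegner points on `X₀(N)`* (1984), §I.1, §4 (4.2). [Gross1984]
-/

set_option autoImplicit false
-- the Summit-side namespace `Summit.BirchSwinnertonDyer.BirchSwinnertonDyer.…` (summit = problem) is mandated by D-0017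
set_option linter.dupNamespace false

noncomputable section

open scoped Classical Cardinal

namespace Summit.BirchSwinnertonDyer.BirchSwinnertonDyer.Theorems.SylvesterTwoLevelFixingEta

open Literature.NumberTheory.EllipticCurves Literature.NumberTheory.EllipticCurves.ModularForms
  Literature.NumberTheory.QuadraticFields.BinaryQuadraticForm Literature.NumberTheory.QuadraticFields.Quadratic
  Literature.Computability.Cryptography.Hallgren2005 Literature.Computability.Cryptography.Hallgren2005.OrderCl
  Literature.NumberTheory.ComplexMultiplication.CMTypeLattice Literature.FieldTheory.AlgClosed
  Summit.BirchSwinnertonDyer.BirchSwinnertonDyer.Theorems.SylvesterTwoLevelFixingGlue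

variable {K : Type} [Field K] [NumberField K]

/-! ## §1 Bookkeeping: `c² d_K ≡ 0, 1 (mod 4)`, `j(κ) ∈ K[c]`, extensions to `Aut(ℂ)` -/

/-- `c² d_K ≡ 0, 1 (mod 4)`. [folklore] -/
theorem sq_mul_discr_emod_four (hK : IsImaginaryQuadratic K) (Δ : NegDiscr) {c : ℕ}
    (hΔ : Δ.D = (c : ℤ) ^ 2 * NumberField.discr K) : Δ.D % 4 = 0 ∨ Δ.D % 4 = 1 := by
  have hd := Literature.NumberTheory.QuadraticFields.Quadratic.discr_emod_four hK.1
  rcases Int.even_or_odd (c : ℤ) with ⟨k, hk⟩ | ⟨k, hk⟩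
  · left
    rw [hΔ, hk, show (k + k) ^ 2 * NumberField.discr K = 4 * (k ^ 2 * NumberField.discr K) by ring]
    exact Int.mul_emod_right _ _
  · have h8 : (c : ℤ) ^ 2 % 4 = 1 := by
      rw [hk, show (2 * k + 1) ^ 2 = 4 * (k ^ 2 + k) + 1 by ring]
      omega
    rw [hΔ, Int.mul_emod, h8, one_mul, Int.emod_emod_of_dvd _ (by norm_num : (4 : ℤ) ∣ 4)]
    exact hd

/-- **`j(κ) ∈ K[c]`** for every class `κ` of the order of discriminant `c² d_K` (Cox Thm. 11.1, through the tree's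
`formJ_mem_ringClassField` on a reduced representative). [cite: Cox2013, §11.A Thm. 11.1] -/
theorem classJ_mem_ringClassField (hK : IsImaginaryQuadratic K) (ι : K →+* ℂ) {c : ℕ} (Δ : NegDiscr)
    (hΔ : Δ.D = (c : ℤ) ^ 2 * NumberField.discr K) (κ : ClassGroup (QO Δ)) :
    classJ Δ κ ∈ ringClassField K ι c := by
  have hD4 := sq_mul_discr_emod_four hK Δ hΔ
  obtain ⟨g, hg, -, rfl⟩ := exists_isReduced_classOf'_eq_of_emod_four Δ hD4 κ
  rw [classJ_classOf' hg]
  refine formJ_mem_ringClassField ι hg.a_pos ((isPrimitive_iff_binQF _).mpr hg.primitive) ?_ (hΔ ▸ Δ.neg)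
  exact hg.disc_eq.trans hΔ

/-- **Every `s ∈ Gal(K[c]/K)` is induced by some `σ ∈ Aut(ℂ)`**, which fixes `ι(K)` pointwise and `√(c² d_K)`
(`K[c]` is countable: `Complex.exists_ringEquiv_apply_eq_of_subfield`). [folklore] -/
theorem exists_ringEquiv_extends (hK : IsImaginaryQuadratic K) (ι : K →+* ℂ) {c : ℕ} (hc : c ≠ 0) (Δ : NegDiscr)
    (hΔ : Δ.D = (c : ℤ) ^ 2 * NumberField.discr K)
    (s : ringClassField K ι c ≃ₐ[K] ringClassField K ι c) :
    ∃ σ : ℂ ≃+* ℂ, (∀ x : ringClassField K ι c, σ x = ((s x : ringClassField K ι c) : ℂ)) ∧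
      (∀ k : K, σ (ι k) = ι k) ∧ σ (sqrtDisc Δ.D) = sqrtDisc Δ.D := by
  have hcount : #(ringClassField K ι c) ≤ ℵ₀ := by
    haveI := (finiteDimensional_and_isGalois_ringClassField hK ι hc).1
    haveI : FiniteDimensional ℚ (ringClassField K ι c) := Module.Finite.trans K (ringClassField K ι c)
    haveI : Algebra.IsAlgebraic ℚ (ringClassField K ι c) := Algebra.IsAlgebraic.of_finite ℚ _
    exact Subfield.cardinalMk_le_aleph0_of_isAlgebraic _
  obtain ⟨σ, hσ⟩ := Complex.exists_ringEquiv_apply_eq_of_subfield (ringClassField K ι c) hcount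
    ((ringClassField K ι c).subtype.comp (s : ringClassField K ι c ≃ₐ[K] ringClassField K ι c).toRingEquiv.toRingHom)
  have hσ' : ∀ x : ringClassField K ι c, σ x = ((s x : ringClassField K ι c) : ℂ) := fun x ↦ by rw [hσ x]; rfl
  have hσK : ∀ k : K, σ (ι k) = ι k := ringEquiv_apply_eq_of_extends ι c s hσ'
  refine ⟨σ, hσ', hσK, ?_⟩
  rw [hΔ, sqrtDisc_sq_mul, map_mul, map_natCast, apply_sqrtDisc_discr_eq hK ι hσK]

/-! ## §2 The class `η(s)` and the translation law -/

/-- **`s(j(1)) = j(η)` for a UNIQUE class `η`** (`s ∈ Gal(K[c]/K)`): existence from the translation law of the order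
(`exists_translation_classJ`) applied to an extension `σ ∈ Aut(ℂ)` of `s`, uniqueness by `classJ_injective`.
[cite: Cox2013, §11.D Cor. 11.37] [cite: Darmon2004, Thm. 3.3] -/
theorem existsUnique_gal_apply_classJ_one_eq (hK : IsImaginaryQuadratic K) (ι : K →+* ℂ) {c : ℕ} (hc : c ≠ 0)
    (Δ : NegDiscr) (hΔ : Δ.D = (c : ℤ) ^ 2 * NumberField.discr K)
    (s : ringClassField K ι c ≃ₐ[K] ringClassField K ι c) :
    ∃! η : ClassGroup (QO Δ),
      ((s ⟨classJ Δ 1, classJ_mem_ringClassField hK ι Δ hΔ 1⟩ : ringClassField K ι c) : ℂ) = classJ Δ η := by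
  have hD4 := sq_mul_discr_emod_four hK Δ hΔ
  obtain ⟨σ, hσ, -, hσD⟩ := exists_ringEquiv_extends hK ι hc Δ hΔ s
  obtain ⟨η, hη⟩ := exists_translation_classJ Δ hD4 hσD
  refine ⟨η, ?_, fun η' hη' ↦ ?_⟩
  · rw [← hσ ⟨classJ Δ 1, classJ_mem_ringClassField hK ι Δ hΔ 1⟩]
    change σ (classJ Δ 1) = classJ Δ η
    rw [hη 1, mul_one]
  · apply classJ_injective hD4
    rw [← hη', ← hσ ⟨classJ Δ 1, classJ_mem_ringClassField hK ι Δ hΔ 1⟩]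
    change σ (classJ Δ 1) = classJ Δ η
    rw [hη 1, mul_one]

/-- **Translation law for `s ∈ Gal(K[c]/K)`**: if `s(j(1)) = j(η)` then `s(j(κ)) = j(η·κ)` for every class `κ`
(extend `s` to `σ ∈ Aut(ℂ)`; `apply_classJ_eq_classJ_mul_of_negDiscr`).
[cite: Cox2013, §11.D Cor. 11.37] [cite: Darmon2004, Thm. 3.7] -/
theorem gal_apply_classJ_eq_classJ_mul (hK : IsImaginaryQuadratic K) (ι : K →+* ℂ) {c : ℕ} (hc : c ≠ 0)
    (Δ : NegDiscr) (hΔ : Δ.D = (c : ℤ) ^ 2 * NumberField.discr K)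
    (s : ringClassField K ι c ≃ₐ[K] ringClassField K ι c) {η : ClassGroup (QO Δ)}
    (hη : ((s ⟨classJ Δ 1, classJ_mem_ringClassField hK ι Δ hΔ 1⟩ : ringClassField K ι c) : ℂ) = classJ Δ η)
    (κ : ClassGroup (QO Δ)) :
    ((s ⟨classJ Δ κ, classJ_mem_ringClassField hK ι Δ hΔ κ⟩ : ringClassField K ι c) : ℂ) = classJ Δ (η * κ) := by
  have hD4 := sq_mul_discr_emod_four hK Δ hΔ
  obtain ⟨σ, hσ, -, hσD⟩ := exists_ringEquiv_extends hK ι hc Δ hΔ s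
  have hη' : σ (classJ Δ 1) = classJ Δ η := by
    rw [hσ ⟨classJ Δ 1, classJ_mem_ringClassField hK ι Δ hΔ 1⟩]; exact hη
  rw [← hσ ⟨classJ Δ κ, classJ_mem_ringClassField hK ι Δ hΔ κ⟩]
  exact apply_classJ_eq_classJ_mul_of_negDiscr Δ hD4 hσD hη' κ

/-! ## §3 ★ The isomorphism `Φ : Gal(K[c]/K) ≃* Cl(𝒪_{c² d_K})` -/

/-- ★ **Hasse's isomorphism for the order of conductor `c`**: there is a group isomorphism
`Φ : Gal(K[c]/K) ≃* Cl(𝒪_{c² d_K})` with `s(j(κ)) = j(Φ(s)·κ)` for all `s` and all classes `κ` — the Artin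
isomorphism of the ring class field (Cox §9.A / Thm. 11.1, Darmon Thm. 3.3) UP TO ITS NAME (no identification
with Frobenius classes is asserted), obtained from the `Aut(ℂ)`-translation law of the order (k-ty1
`exists_translation_classJ`) exactly as `galClassEquiv` is obtained for the maximal order: a homomorphism by
`classJ_injective`, injective because an automorphism of `ℂ` fixing `ι(K)` and one singular modulus of discriminant
`c² d_K` fixes `K[c]` (`eqOn_ringClassField_of_apply_formJ_eq`), bijective since
`#Gal(K[c]/K) = h(c² d_K) = #Cl(𝒪_{c² d_K})`.
[cite: Cox2013, §9.A, §11.A Thm. 11.1, §7.D Thm. 7.24] [cite: Darmon2004, Thm. 3.3 and Thm. 3.7] [cite: Gross1984, §4 (4.2)] -/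
theorem exists_galClassEquiv_ringClassField (hK : IsImaginaryQuadratic K) (ι : K →+* ℂ) {c : ℕ} (hc : c ≠ 0)
    (Δ : NegDiscr) (hΔ : Δ.D = (c : ℤ) ^ 2 * NumberField.discr K) :
    ∃ Φ : (ringClassField K ι c ≃ₐ[K] ringClassField K ι c) ≃* ClassGroup (QO Δ),
      ∀ (s : ringClassField K ι c ≃ₐ[K] ringClassField K ι c) (κ : ClassGroup (QO Δ)),
        ((s ⟨classJ Δ κ, classJ_mem_ringClassField hK ι Δ hΔ κ⟩ : ringClassField K ι c) : ℂ) =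
          classJ Δ (Φ s * κ) := by
  have hD4 := sq_mul_discr_emod_four hK Δ hΔ
  -- the function `Φ₀ s = η(s)`
  choose Φ₀ hΦ₀ _ using fun s : ringClassField K ι c ≃ₐ[K] ringClassField K ι c ↦
    existsUnique_gal_apply_classJ_one_eq hK ι hc Δ hΔ s
  have hlaw : ∀ s κ, ((s ⟨classJ Δ κ, classJ_mem_ringClassField hK ι Δ hΔ κ⟩ : ringClassField K ι c) : ℂ) =
      classJ Δ (Φ₀ s * κ) := fun s κ ↦ gal_apply_classJ_eq_classJ_mul hK ι hc Δ hΔ s (hΦ₀ s) κ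
  -- multiplicativity
  have hmul : ∀ s t, Φ₀ (s * t) = Φ₀ s * Φ₀ t := by
    intro s t
    apply classJ_injective hD4
    rw [← hΦ₀ (s * t), AlgEquiv.mul_apply]
    have hts : t ⟨classJ Δ 1, classJ_mem_ringClassField hK ι Δ hΔ 1⟩ =
        ⟨classJ Δ (Φ₀ t), classJ_mem_ringClassField hK ι Δ hΔ _⟩ := by
      apply Subtype.ext
      have h := hΦ₀ t
      exact h
    rw [hts, hlaw s]
  set ΦHom : (ringClassField K ι c ≃ₐ[K] ringClassField K ι c) →* ClassGroup (QO Δ) := MonoidHom.mk' Φ₀ hmul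
    with hΦHom
  have hΦHom_apply : ∀ s, ΦHom s = Φ₀ s := fun _ ↦ rfl
  -- injectivity: `Φ₀ u = 1 ⇒ u = 1`
  have hone : ∀ u : ringClassField K ι c ≃ₐ[K] ringClassField K ι c, Φ₀ u = 1 → u = 1 := by
    intro u hu
    obtain ⟨σ, hσ, hσK, -⟩ := exists_ringEquiv_extends hK ι hc Δ hΔ u
    -- `σ` fixes `ι(K)` and `j(τ_P)`, `P` the principal form, hence `K[c]`
    obtain ⟨hdP, hAP, hprimP, -⟩ := (mem_reducedForms_iff Δ.neg).1 (principalForm_mem_reducedForms Δ.neg hD4)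
    have hjP : σ (formJ (principalForm Δ.D)) = formJ (principalForm Δ.D) := by
      rw [← classJ_one Δ hD4, hσ ⟨classJ Δ 1, classJ_mem_ringClassField hK ι Δ hΔ 1⟩, hlaw u 1, hu, mul_one]
    have heq : Set.EqOn (σ : ℂ →+* ℂ) (RingHom.id ℂ) (ringClassField K ι c) :=
      eqOn_ringClassField_of_apply_formJ_eq hK ι hc (Q := principalForm Δ.D) hAP hprimP (hdP.trans hΔ)
        (fun k ↦ by simpa using hσK k) (by simpa using hjP)
    refine AlgEquiv.ext fun x ↦ Subtype.ext ?_
    have h1 : σ x = x := heq x.2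
    rw [hσ x] at h1
    simpa using h1
  have hinj : Function.Injective ΦHom := by
    intro s t hst
    rw [hΦHom_apply, hΦHom_apply] at hst
    have h1 : Φ₀ (t⁻¹ * s) = 1 := by
      rw [hmul, hst, ← hmul, inv_mul_cancel]
      apply classJ_injective hD4
      rw [← hΦ₀ 1]
      rfl
    have := hone _ h1
    rw [inv_mul_eq_one] at this
    exact this.symm
  -- bijectivity by counting
  have hbij : Function.Bijective ΦHom := by
    haveI : Finite (ClassGroup (QO Δ)) := finite_classGroup_QO_of_emod_four Δ hD4
    haveI := (finiteDimensional_and_isGalois_ringClassField hK ι hc).1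
    refine hinj.bijective_of_nat_card_le (le_of_eq ?_)
    rw [natCard_classGroup_QO_of_emod_four Δ hD4, card_algEquiv_ringClassField_eq_classNumber hK ι hc, hΔ]
  exact ⟨MulEquiv.ofBijective ΦHom hbij, fun s κ ↦ by rw [MulEquiv.ofBijective_apply, hΦHom_apply]; exact hlaw s κ⟩

/-! ## §4 Reading `Φ` on extensions to `Aut(ℂ)` -/

/-- **`σ(j(κ)) = j(Φ(s)·κ)` for any `σ ∈ Aut(ℂ)` extending `s`** (with `Φ` as in `exists_galClassEquiv_ringClassField`,
or any map satisfying its translation law). [cite: Darmon2004, Thm. 3.7] -/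
theorem ringEquiv_apply_classJ_of_extends (hK : IsImaginaryQuadratic K) (ι : K →+* ℂ) {c : ℕ}
    (Δ : NegDiscr) (hΔ : Δ.D = (c : ℤ) ^ 2 * NumberField.discr K)
    {Φ : (ringClassField K ι c ≃ₐ[K] ringClassField K ι c) → ClassGroup (QO Δ)}
    (hΦ : ∀ (s : ringClassField K ι c ≃ₐ[K] ringClassField K ι c) (κ : ClassGroup (QO Δ)),
      ((s ⟨classJ Δ κ, classJ_mem_ringClassField hK ι Δ hΔ κ⟩ : ringClassField K ι c) : ℂ) = classJ Δ (Φ s * κ))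
    (s : ringClassField K ι c ≃ₐ[K] ringClassField K ι c) {σ : ℂ ≃+* ℂ}
    (hσ : ∀ x : ringClassField K ι c, σ x = ((s x : ringClassField K ι c) : ℂ)) (κ : ClassGroup (QO Δ)) :
    σ (classJ Δ κ) = classJ Δ (Φ s * κ) := by
  rw [hσ ⟨classJ Δ κ, classJ_mem_ringClassField hK ι Δ hΔ κ⟩]
  exact hΦ s κ

/-- **Uniqueness of the translating class**: if `σ ∈ Aut(ℂ)` extends `s` and `σ(j(κ)) = j(η·κ)` for all `κ`
(e.g. `η` from `exists_translation_classJ`), then `η = Φ(s)`. [cite: Cox2013, §11.D Cor. 11.37] -/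
theorem eq_galClass_of_extends (hK : IsImaginaryQuadratic K) (ι : K →+* ℂ) {c : ℕ}
    (Δ : NegDiscr) (hΔ : Δ.D = (c : ℤ) ^ 2 * NumberField.discr K)
    {Φ : (ringClassField K ι c ≃ₐ[K] ringClassField K ι c) → ClassGroup (QO Δ)}
    (hΦ : ∀ (s : ringClassField K ι c ≃ₐ[K] ringClassField K ι c) (κ : ClassGroup (QO Δ)),
      ((s ⟨classJ Δ κ, classJ_mem_ringClassField hK ι Δ hΔ κ⟩ : ringClassField K ι c) : ℂ) = classJ Δ (Φ s * κ))
    (s : ringClassField K ι c ≃ₐ[K] ringClassField K ι c) {σ : ℂ ≃+* ℂ}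
    (hσ : ∀ x : ringClassField K ι c, σ x = ((s x : ringClassField K ι c) : ℂ)) {η : ClassGroup (QO Δ)}
    (hη : ∀ κ : ClassGroup (QO Δ), σ (classJ Δ κ) = classJ Δ (η * κ)) : η = Φ s := by
  have hD4 := sq_mul_discr_emod_four hK Δ hΔ
  apply classJ_injective hD4
  have h1 := hη 1
  have h2 := ringEquiv_apply_classJ_of_extends hK ι Δ hΔ hΦ s hσ 1
  rw [mul_one] at h1 h2
  rw [← h1, h2]

/-- **`Φ(s)² = 1` when `s² = 1`**, and more generally `Φ` is compatible with the group law (packaged reading for the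
involutions of the sequel). [cite: Darmon2004, Thm. 3.3] -/
theorem galClass_sq_eq_one_of_sq (hK : IsImaginaryQuadratic K) (ι : K →+* ℂ) {c : ℕ}
    (Δ : NegDiscr)
    (Φ : (ringClassField K ι c ≃ₐ[K] ringClassField K ι c) ≃* ClassGroup (QO Δ))
    {s : ringClassField K ι c ≃ₐ[K] ringClassField K ι c} (hs : s * s = 1) : Φ s ^ 2 = 1 := by
  have _ := hK
  have _ := ι
  rw [sq, ← map_mul, hs, map_one]

end Summit.BirchSwinnertonDyer.BirchSwinnertonDyer.Theorems.SylvesterTwoLevelFixingEta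

end
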